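import Summits.AtomisticToContinuum.HydrodynamicLimit.Theorems.AntiMazurCoboundariesInfluenceLocalityTrueCapsExistPrelimF
import Summits.AtomisticToContinuum.HydrodynamicLimit.Theorems.AntiMazurCoboundariesInfluenceLocalityTrueCapsExistPrelimG

/-!
# Stub `stub_trueCapsExist` of the line `true-anchored-infection` (crux `InfluenceLocality`,
# stmt-AtomisticToContinuum-13916; route AntiMazurCoboundaries): TRUE CAPS EXIST

`theorem stub_trueCapsExist : TrueCapsExist` — for every activity `a > 0`, temperature `θ > 0`
and drift `u₀` there is `σ₀ > 0` such that for all reduced densities `0 < σ < σ₀` and horizons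
`T > 0` the speed-cap schedule `u(R) = (θ√R)^{1/2}` (`TrueCaps.capSpeed`, admissible:
`u(R)² = θ√R`) is GENUINE on the true side (`TrueCapTail`): uniformly in the label `i`, the flow
`Φ` and `N ≥ 1`, the `G_N`-probability that some true sphere is faster than `u(R)` relative to
`u₀` at some rational grid time of `[0, Tℓ]` while within `(R + D(R))ℓ` of the initial position
of `i` is at most `C(σ, θ, u₀, T) (1 + R)³ · 2^{3/2} e^{-√R/4} → 0`.

Assembly of the prelims: the fixed-`(R, N)` bound `trueCaps_isHot_le` (flight-start alternative
on good orbits, stationarity of `G_N` under the flow, the collision-flux (Rice) inequality of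
Cercignani–Illner–Pulvirenti App. 4.A as `measure_collisionSum_ge_le_liminf`, the Ruelle-type pair
and triple bounds of the canonical hard-sphere gas at small reduced density
`σ₀ = exists_smallDensity uniformProfile`), the Maxwellian-tail estimates of the Gaussian flux
integrals (`TrueCaps.fastFlux_le`, `TrueCaps.ballFlux_le`, `trueCaps_nearFlux_le`), and the
bookkeeping `N ε² τ = σ² T · N ℓ³ ≤ σ² T`, `(radius) = ℓ · O(1 + R)` that makes the bound uniform in
`N` (`TrueCaps.isHot_le_unif`), followed by `(1 + R)³ e^{-√R/4} → 0`
(`TrueCaps.exists_cube_mul_exp_neg_sqrt_le`).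
-/

namespace Summit.AtomisticToContinuum.HydrodynamicLimit.Theorems.TrueAnchoredInfection

open MeasureTheory Set Filter Topology
open scoped ENNReal
open Literature.Analysis.FluidPDE Literature.MathematicalPhysics.KineticTheory
open Literature.Analysis.FunctionSpaces

noncomputable section

namespace TrueCaps

/-! ## Bookkeeping in the units `ℓ = (N+1)^{-1/3}` -/

/-- `ℓ³ = 1/(N+1)`. -/
theorem ell_pow_three (N : ℕ) : ell N ^ 3 = 1 / ((N : ℝ) + 1) := by
  have h := hsDiameter_pow_three 1 N
  have h1 : hsDiameter 1 N = ell N := one_mul _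
  rw [h1, one_pow, Nat.cast_add, Nat.cast_one] at h
  exact h

/-- `ε = σ ℓ`. -/
theorem hsDiameter_eq (σ : ℝ) (N : ℕ) : hsDiameter σ N = σ * ell N := rfl

/-- `ℓ > 0`. -/
theorem ell_pos (N : ℕ) : 0 < ell N := Real.rpow_pos_of_pos (by positivity) _

/-- `N ε² τ ≤ σ² T` for `τ = Tℓ` (`T ≥ 0`). -/
theorem natCast_mul_sq_mul_le {σ T : ℝ} (hT : 0 ≤ T) (N : ℕ) :
    (N : ℝ) * hsDiameter σ N ^ 2 * (T * ell N) ≤ σ ^ 2 * T := by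
  have h3 := ell_pow_three N
  have hN1 : (0 : ℝ) < (N : ℝ) + 1 := by positivity
  have hkey : (N : ℝ) * ell N ^ 3 ≤ 1 := by
    rw [h3, mul_one_div, div_le_one hN1]; linarith
  calc (N : ℝ) * hsDiameter σ N ^ 2 * (T * ell N) = σ ^ 2 * T * ((N : ℝ) * ell N ^ 3) := by rw [hsDiameter_eq]; ring
    _ ≤ σ ^ 2 * T * 1 := by gcongr
    _ = σ ^ 2 * T := mul_one _

/-- `N ℓ³ ≤ 1`. -/
theorem natCast_mul_ell_pow_three_le (N : ℕ) : (N : ℝ) * ell N ^ 3 ≤ 1 := by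
  have hN1 : (0 : ℝ) < (N : ℝ) + 1 := by positivity
  rw [ell_pow_three N, mul_one_div, div_le_one hN1]; linarith

/-- `N (N+1) ε² τ ℓ³ ≤ σ² T` for `τ = Tℓ` (`T ≥ 0`). -/
theorem natCast_mul_succ_mul_le {σ T : ℝ} (hT : 0 ≤ T) (N : ℕ) :
    (N : ℝ) * ((N : ℝ) + 1) * hsDiameter σ N ^ 2 * (T * ell N) * ell N ^ 3 ≤ σ ^ 2 * T := by
  have h3 := ell_pow_three N
  have hN1 : (0 : ℝ) < (N : ℝ) + 1 := by positivity
  have hkey : (N : ℝ) * ((N : ℝ) + 1) * ell N ^ 3 * ell N ^ 3 ≤ 1 := by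
    rw [h3]; field_simp; linarith
  calc (N : ℝ) * ((N : ℝ) + 1) * hsDiameter σ N ^ 2 * (T * ell N) * ell N ^ 3
      = σ ^ 2 * T * ((N : ℝ) * ((N : ℝ) + 1) * ell N ^ 3 * ell N ^ 3) := by rw [hsDiameter_eq]; ring
    _ ≤ σ ^ 2 * T * 1 := by gcongr
    _ = σ ^ 2 * T := mul_one _

/-- The range-dependent constant `Λ = 1 + 3Tθ + 6T + 6T‖c‖ + 2σ` of the radius bound. -/
def Lam (σ θ T : ℝ) (c : V3) : ℝ := 1 + 3 * T * θ + 6 * T + 6 * T * ‖c‖ + 2 * σ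

/-- **The radii are `ℓ · O(1 + R)`**: with `u = capSpeed θ R`, `V = u + ‖c‖`, `τ = Tℓ`,
`ρ = (R + haloMargin c σ T u) ℓ + V τ`, both `ρ + Vτ + τ‖c‖ + τ` and `ρ + Vτ + 3τ‖c‖ + 3τ` are at
most `ℓ (1 + R) Λ` (`R ≥ 1`, `σ, θ, T ≥ 0`). -/
theorem radius_le {σ θ T R : ℝ} (hσ : 0 ≤ σ) (hθ : 0 ≤ θ) (hT : 0 ≤ T) (hR : 1 ≤ R) (c : V3) (N : ℕ) :
    let u := capSpeed θ R
    (R + haloMargin c σ T u) * ell N + (u + ‖c‖) * (T * ell N) + (u + ‖c‖) * (T * ell N) + (T * ell N) * ‖c‖ + T * ell N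
        ≤ ell N * ((1 + R) * Lam σ θ T c) ∧
    (R + haloMargin c σ T u) * ell N + (u + ‖c‖) * (T * ell N) + (u + ‖c‖) * (T * ell N) + 3 * (T * ell N) * ‖c‖ + 3 * (T * ell N)
        ≤ ell N * ((1 + R) * Lam σ θ T c) := by
  intro u
  have hℓ := (ell_pos N).le
  have hu : u ≤ 1 + θ * R := capSpeed_le hθ hR
  have hu0 : 0 ≤ u := capSpeed_nonneg θ R
  have hc := norm_nonneg c
  have hA : R + haloMargin c σ T u + (u + ‖c‖) * T + (u + ‖c‖) * T + 3 * T * ‖c‖ + 3 * T ≤ (1 + R) * Lam σ θ T c := by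
    simp only [haloMargin, Lam]
    have h3 : 3 * T * u ≤ 3 * T * (1 + θ * R) := mul_le_mul_of_nonneg_left hu (by positivity)
    nlinarith [mul_nonneg hT hθ, mul_nonneg (mul_nonneg hT hθ) (by linarith : (0 : ℝ) ≤ R),
      mul_nonneg hT hc, mul_nonneg hT (by linarith : (0 : ℝ) ≤ R), mul_nonneg (mul_nonneg hT hc) (by linarith : (0 : ℝ) ≤ R),
      mul_nonneg hσ (by linarith : (0 : ℝ) ≤ R)]
  have hB : R + haloMargin c σ T u + (u + ‖c‖) * T + (u + ‖c‖) * T + T * ‖c‖ + T ≤ (1 + R) * Lam σ θ T c := by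
    refine le_trans ?_ hA
    nlinarith [mul_nonneg hT hc]
  constructor
  · calc _ = ell N * (R + haloMargin c σ T u + (u + ‖c‖) * T + (u + ‖c‖) * T + T * ‖c‖ + T) := by ring
      _ ≤ ell N * ((1 + R) * Lam σ θ T c) := mul_le_mul_of_nonneg_left hB hℓ
  · calc _ = ell N * (R + haloMargin c σ T u + (u + ‖c‖) * T + (u + ‖c‖) * T + 3 * T * ‖c‖ + 3 * T) := by ring
      _ ≤ ell N * ((1 + R) * Lam σ θ T c) := mul_le_mul_of_nonneg_left hA hℓ

/-- The `N`-free constant of the final bound. -/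
def Ctot (σ θ T : ℝ) (c : V3) : ℝ≥0∞ :=
  1 + ENNReal.ofReal (32 * σ ^ 2 * T) * Kmom c (2 * θ) 1 * Kmom c θ 1 +
    ENNReal.ofReal (4 * Lam σ θ T c ^ 3) * volume (Metric.ball (0 : V3) 1) * Kmom c (2 * θ) 3 +
    ENNReal.ofReal (32 * σ ^ 2 * T * Lam σ θ T c ^ 3) * volume (Metric.ball (0 : V3) 1) *
      Kmom c (2 * θ) 4 * Kmom c θ 1 * Kmom c θ 3

/-- The constant is finite. -/
theorem Ctot_ne_top (σ θ T : ℝ) (c : V3) : Ctot σ θ T c ≠ ∞ := by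
  have hb : volume (Metric.ball (0 : V3) 1) ≠ ∞ := measure_ball_lt_top.ne
  have h1 := Kmom_ne_top c (2 * θ) 1
  have h2 := Kmom_ne_top c θ 1
  have h3 := Kmom_ne_top c (2 * θ) 3
  have h4 := Kmom_ne_top c (2 * θ) 4
  have h5 := Kmom_ne_top c θ 3
  unfold Ctot
  apply_rules [ENNReal.add_ne_top.2, And.intro, ENNReal.mul_ne_top, ENNReal.ofReal_ne_top, ENNReal.one_ne_top]

/-- **The bound for the hot event, uniformly in `N`**: along the schedule `u = capSpeed θ R`,
`G_N{IsHot} ≤ tailC θ u · (1 + R)³ · Ctot` for `R ≥ 1`, `N ≥ 1`. -/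
theorem isHot_le_unif {σ a θ : ℝ} (c : V3) {N : ℕ} (Φ : Flow σ N) {T R : ℝ} (i : Fin (N + 1))
    (hsd : SmallDensity uniformProfile σ) (ha : 0 < a) (hθ : 0 < θ) (hT : 0 < T) (hR : 1 ≤ R) (hN : 1 ≤ N) :
    gibbs σ a θ c N Φ {z | IsHot σ T N Φ c (capSpeed θ R) (R + haloMargin c σ T (capSpeed θ R)) z i} ≤
      ENNReal.ofReal (tailC θ (capSpeed θ R) * (1 + R) ^ 3) * Ctot σ θ T c := by
  set u := capSpeed θ R with hudef
  have hu : 0 ≤ u := capSpeed_nonneg θ R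
  have hσ := hsd.σ_pos.le
  have hℓ := (ell_pos N).le
  set τ := T * ell N with hτdef
  have hτ : 0 ≤ τ := by positivity
  set V := u + ‖c‖ with hVdef
  have hV : 0 ≤ V := by positivity
  set ρ := (R + haloMargin c σ T u) * ell N + V * τ with hρdef
  have hρ : 0 ≤ ρ := by simp only [hρdef, haloMargin]; positivity
  set t := ENNReal.ofReal (tailC θ u) with ht
  set L := Lam σ θ T c with hL
  have hR0 : 0 ≤ R := by linarith
  have hR1 : 1 ≤ (1 + R) ^ 3 := one_le_pow₀ (by linarith)
  obtain ⟨hrad1, hrad2⟩ := radius_le hσ hθ.le hT.le hR c N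
  -- the three flux bounds, in the units of the statement
  have hK : (N : ℝ) * hsDiameter σ N ^ 2 * τ ≤ σ ^ 2 * T := natCast_mul_sq_mul_le hT.le N
  have hF : fastFlux c θ u ≤ t * Kmom c (2 * θ) 1 * Kmom c θ 1 := fastFlux_le hθ hu c
  have hB : ballFlux c θ u ρ V τ ≤ t * ENNReal.ofReal (ell N ^ 3 * ((1 + R) ^ 3 * L ^ 3)) * Kmom c (2 * θ) 3 := by
    refine (ballFlux_le hθ hu hρ hV hτ c).trans ?_
    gcongr
    rw [← mul_pow, ← mul_pow]
    exact pow_le_pow_left₀ (by positivity) hrad1 3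
  have hJ : nearFlux c θ u ρ V τ ≤ t * ENNReal.ofReal (ell N ^ 3 * ((1 + R) ^ 3 * L ^ 3)) *
      Kmom c (2 * θ) 4 * Kmom c θ 1 * Kmom c θ 3 := by
    refine (trueCaps_nearFlux_le θ u ρ V τ c hθ hu hρ hV hτ).trans ?_
    gcongr
    rw [← mul_pow, ← mul_pow]
    exact pow_le_pow_left₀ (by positivity) hrad2 3
  have key := trueCaps_isHot_le σ a θ c N Φ T R u i hsd ha hθ hT hR0 hu hN
  refine key.trans ?_
  -- term by term
  have e1 : t ≤ ENNReal.ofReal (tailC θ u * (1 + R) ^ 3) * 1 := by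
    rw [mul_one]; exact ENNReal.ofReal_le_ofReal (le_mul_of_one_le_right (tailC_nonneg θ u) hR1)
  have e2 : ENNReal.ofReal (16 * N * hsDiameter σ N ^ 2 * τ) * fastFlux c θ u ≤
      ENNReal.ofReal (tailC θ u * (1 + R) ^ 3) * (ENNReal.ofReal (16 * σ ^ 2 * T) * Kmom c (2 * θ) 1 * Kmom c θ 1) := by
    calc ENNReal.ofReal (16 * N * hsDiameter σ N ^ 2 * τ) * fastFlux c θ u
        ≤ ENNReal.ofReal (16 * σ ^ 2 * T) * (t * Kmom c (2 * θ) 1 * Kmom c θ 1) :=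
          mul_le_mul' (ENNReal.ofReal_le_ofReal (by nlinarith [hK])) hF
      _ = t * (ENNReal.ofReal (16 * σ ^ 2 * T) * Kmom c (2 * θ) 1 * Kmom c θ 1) := by ring
      _ ≤ _ := by
          gcongr
          exact ENNReal.ofReal_le_ofReal (le_mul_of_one_le_right (tailC_nonneg θ u) hR1)
  have e3 : (N : ℝ≥0∞) * (4 * volume (Metric.ball (0 : V3) 1) * ballFlux c θ u ρ V τ) ≤
      ENNReal.ofReal (tailC θ u * (1 + R) ^ 3) * (ENNReal.ofReal (4 * L ^ 3) * volume (Metric.ball (0 : V3) 1) * Kmom c (2 * θ) 3) := by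
    calc (N : ℝ≥0∞) * (4 * volume (Metric.ball (0 : V3) 1) * ballFlux c θ u ρ V τ)
        ≤ (N : ℝ≥0∞) * (4 * volume (Metric.ball (0 : V3) 1) *
            (t * ENNReal.ofReal (ell N ^ 3 * ((1 + R) ^ 3 * L ^ 3)) * Kmom c (2 * θ) 3)) := by gcongr
      _ = t * (ENNReal.ofReal 4 * (N : ℝ≥0∞) * ENNReal.ofReal (ell N ^ 3 * ((1 + R) ^ 3 * L ^ 3))) *
            volume (Metric.ball (0 : V3) 1) * Kmom c (2 * θ) 3 := by
          rw [← ENNReal.ofReal_ofNat 4]; ring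
      _ ≤ t * ENNReal.ofReal ((1 + R) ^ 3 * (4 * L ^ 3)) * volume (Metric.ball (0 : V3) 1) * Kmom c (2 * θ) 3 := by
          gcongr
          rw [← ENNReal.ofReal_natCast, ← ENNReal.ofReal_mul (by norm_num), ← ENNReal.ofReal_mul (by positivity)]
          refine ENNReal.ofReal_le_ofReal ?_
          have h := natCast_mul_ell_pow_three_le N
          nlinarith [h, mul_nonneg (pow_nonneg (by linarith : (0 : ℝ) ≤ 1 + R) 3) (pow_nonneg (show 0 ≤ L by simp only [hL, Lam]; positivity) 3)]
      _ = _ := by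
          rw [ENNReal.ofReal_mul (by positivity), ENNReal.ofReal_mul (tailC_nonneg θ u)]; ring
  have e4 : (N : ℝ≥0∞) * (ENNReal.ofReal (16 * hsDiameter σ N ^ 2 * τ) * fastFlux c θ u) ≤
      ENNReal.ofReal (tailC θ u * (1 + R) ^ 3) * (ENNReal.ofReal (16 * σ ^ 2 * T) * Kmom c (2 * θ) 1 * Kmom c θ 1) := by
    refine le_trans (le_of_eq ?_) e2
    rw [← mul_assoc, ← ENNReal.ofReal_natCast, ← ENNReal.ofReal_mul (Nat.cast_nonneg _)]
    congr 2; ring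
  have e5 : (N : ℝ≥0∞) * (ENNReal.ofReal (32 * (N + 1) * hsDiameter σ N ^ 2 * τ) * volume (Metric.ball (0 : V3) 1) *
      nearFlux c θ u ρ V τ) ≤ ENNReal.ofReal (tailC θ u * (1 + R) ^ 3) *
        (ENNReal.ofReal (32 * σ ^ 2 * T * L ^ 3) * volume (Metric.ball (0 : V3) 1) * Kmom c (2 * θ) 4 * Kmom c θ 1 * Kmom c θ 3) := by
    calc (N : ℝ≥0∞) * (ENNReal.ofReal (32 * (N + 1) * hsDiameter σ N ^ 2 * τ) * volume (Metric.ball (0 : V3) 1) *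
          nearFlux c θ u ρ V τ)
        ≤ (N : ℝ≥0∞) * (ENNReal.ofReal (32 * (N + 1) * hsDiameter σ N ^ 2 * τ) * volume (Metric.ball (0 : V3) 1) *
            (t * ENNReal.ofReal (ell N ^ 3 * ((1 + R) ^ 3 * L ^ 3)) * Kmom c (2 * θ) 4 * Kmom c θ 1 * Kmom c θ 3)) := by
          gcongr
      _ = t * ((N : ℝ≥0∞) * ENNReal.ofReal (32 * (N + 1) * hsDiameter σ N ^ 2 * τ) *
            ENNReal.ofReal (ell N ^ 3 * ((1 + R) ^ 3 * L ^ 3))) * volume (Metric.ball (0 : V3) 1) *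
              Kmom c (2 * θ) 4 * Kmom c θ 1 * Kmom c θ 3 := by ring
      _ ≤ t * ENNReal.ofReal ((1 + R) ^ 3 * (32 * σ ^ 2 * T * L ^ 3)) * volume (Metric.ball (0 : V3) 1) *
              Kmom c (2 * θ) 4 * Kmom c θ 1 * Kmom c θ 3 := by
          gcongr
          rw [← ENNReal.ofReal_natCast, ← ENNReal.ofReal_mul (Nat.cast_nonneg _), ← ENNReal.ofReal_mul (by positivity)]
          refine ENNReal.ofReal_le_ofReal ?_
          have h : (N : ℝ) * ((N : ℝ) + 1) * hsDiameter σ N ^ 2 * τ * ell N ^ 3 ≤ σ ^ 2 * T := natCast_mul_succ_mul_le hT.le N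
          nlinarith [h, mul_nonneg (pow_nonneg (by linarith : (0 : ℝ) ≤ 1 + R) 3) (pow_nonneg (show 0 ≤ L by simp only [hL, Lam]; positivity) 3)]
      _ = _ := by
          rw [ENNReal.ofReal_mul (by positivity), ENNReal.ofReal_mul (tailC_nonneg θ u)]; ring
  calc t + ENNReal.ofReal (16 * N * hsDiameter σ N ^ 2 * τ) * fastFlux c θ u +
        N * (4 * volume (Metric.ball (0 : V3) 1) * ballFlux c θ u ρ V τ +
          (ENNReal.ofReal (16 * hsDiameter σ N ^ 2 * τ) * fastFlux c θ u +
            ENNReal.ofReal (32 * (N + 1) * hsDiameter σ N ^ 2 * τ) * volume (Metric.ball (0 : V3) 1) * nearFlux c θ u ρ V τ))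
      = t + ENNReal.ofReal (16 * N * hsDiameter σ N ^ 2 * τ) * fastFlux c θ u +
          ((N : ℝ≥0∞) * (4 * volume (Metric.ball (0 : V3) 1) * ballFlux c θ u ρ V τ) +
            ((N : ℝ≥0∞) * (ENNReal.ofReal (16 * hsDiameter σ N ^ 2 * τ) * fastFlux c θ u) +
              (N : ℝ≥0∞) * (ENNReal.ofReal (32 * (N + 1) * hsDiameter σ N ^ 2 * τ) * volume (Metric.ball (0 : V3) 1) *
                nearFlux c θ u ρ V τ))) := by ring
    _ ≤ ENNReal.ofReal (tailC θ u * (1 + R) ^ 3) * 1 +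
          ENNReal.ofReal (tailC θ u * (1 + R) ^ 3) * (ENNReal.ofReal (16 * σ ^ 2 * T) * Kmom c (2 * θ) 1 * Kmom c θ 1) +
          (ENNReal.ofReal (tailC θ u * (1 + R) ^ 3) * (ENNReal.ofReal (4 * L ^ 3) * volume (Metric.ball (0 : V3) 1) * Kmom c (2 * θ) 3) +
            (ENNReal.ofReal (tailC θ u * (1 + R) ^ 3) * (ENNReal.ofReal (16 * σ ^ 2 * T) * Kmom c (2 * θ) 1 * Kmom c θ 1) +
              ENNReal.ofReal (tailC θ u * (1 + R) ^ 3) *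
                (ENNReal.ofReal (32 * σ ^ 2 * T * L ^ 3) * volume (Metric.ball (0 : V3) 1) * Kmom c (2 * θ) 4 * Kmom c θ 1 * Kmom c θ 3))) :=
        add_le_add (add_le_add e1 e2) (add_le_add e3 (add_le_add e4 e5))
    _ = ENNReal.ofReal (tailC θ u * (1 + R) ^ 3) * Ctot σ θ T c := by
        rw [Ctot, ← hL]
        have h16 : ENNReal.ofReal (16 * σ ^ 2 * T) + ENNReal.ofReal (16 * σ ^ 2 * T) = ENNReal.ofReal (32 * σ ^ 2 * T) := by
          rw [← ENNReal.ofReal_add (by positivity) (by positivity)]; congr 1; ring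
        rw [← h16]
        ring

end TrueCaps

open TrueCaps in
/-- **STUB 4 of the line `true-anchored-infection`: TRUE CAPS EXIST.** For every `a, θ > 0` and
drift `u₀` there is `σ₀ > 0` (the small-density threshold of the Ruelle bounds,
`exists_smallDensity uniformProfile`) such that for `0 < σ < σ₀` and every horizon `T > 0` the
schedule `u(R) = (θ√R)^{1/2}` is an admissible cap (`u(R)² = θ√R`) and is genuine on the true side:
for every `η > 0` there is `R₀` such that for `R ≥ R₀`, `N ≥ 1`, every flow `Φ` and label `i`,
`G_N{IsHot σ T N Φ u₀ (u R) (R + haloMargin u₀ σ T (u R)) · i} ≤ η`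
(`TrueCaps.isHot_le_unif` and the decay `(1 + R)³ e^{-√R/4} → 0`). -/
theorem stub_trueCapsExist : TrueCapsExist := by
  intro a θ u₀ ha hθ
  obtain ⟨σ₀, hσ₀, hsmall⟩ := exists_smallDensity uniformProfile one_pos
  refine ⟨σ₀, hσ₀, fun σ hσ hσlt T hT => ?_⟩
  have hsd : SmallDensity uniformProfile σ := (hsmall σ hσ hσlt).1
  refine ⟨fun R => capSpeed θ R, ⟨1, one_pos, fun R hR => ⟨capSpeed_pos hθ (by linarith), ?_⟩⟩, ?_⟩
  · rw [capSpeed_sq hθ.le]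
  intro η hη
  set C := Ctot σ θ T u₀ with hC
  have hCtop : C ≠ ∞ := Ctot_ne_top σ θ T u₀
  set η' : ℝ := η / ((2 : ℝ) ^ ((3 : ℝ) / 2) * (C.toReal + 1)) with hη'
  have h232 : (0 : ℝ) < (2 : ℝ) ^ ((3 : ℝ) / 2) := by positivity
  have hη'pos : 0 < η' := div_pos hη (mul_pos h232 (by positivity))
  obtain ⟨R₁, hR₁, hdec⟩ := exists_cube_mul_exp_neg_sqrt_le hη'pos
  refine ⟨max R₁ 1, lt_max_of_lt_left hR₁, fun R hR => ⟨1, fun N hN Φ i => ?_⟩⟩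
  have hR1 : 1 ≤ R := le_trans (le_max_right _ _) hR
  have hRR : R₁ ≤ R := le_trans (le_max_left _ _) hR
  refine (isHot_le_unif u₀ Φ i hsd ha hθ hT hR1 hN).trans ?_
  rw [tailC_capSpeed hθ R]
  have hmain : (2 : ℝ) ^ ((3 : ℝ) / 2) * Real.exp (-(Real.sqrt R / 4)) * (1 + R) ^ 3 ≤ (2 : ℝ) ^ ((3 : ℝ) / 2) * η' := by
    rw [mul_assoc]
    refine mul_le_mul_of_nonneg_left ?_ h232.le
    rw [mul_comm]
    exact hdec R hRR
  calc ENNReal.ofReal ((2 : ℝ) ^ ((3 : ℝ) / 2) * Real.exp (-(Real.sqrt R / 4)) * (1 + R) ^ 3) * C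
      ≤ ENNReal.ofReal ((2 : ℝ) ^ ((3 : ℝ) / 2) * η') * ENNReal.ofReal C.toReal := by
        rw [ENNReal.ofReal_toReal hCtop]
        gcongr
    _ = ENNReal.ofReal ((2 : ℝ) ^ ((3 : ℝ) / 2) * η' * C.toReal) := by rw [← ENNReal.ofReal_mul (by positivity)]
    _ ≤ ENNReal.ofReal η := by
        refine ENNReal.ofReal_le_ofReal ?_
        have hCr : 0 ≤ C.toReal := ENNReal.toReal_nonneg
        rw [hη']
        rw [show (2 : ℝ) ^ ((3 : ℝ) / 2) * (η / ((2 : ℝ) ^ ((3 : ℝ) / 2) * (C.toReal + 1))) * C.toReal =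
          η * (C.toReal / (C.toReal + 1)) by field_simp]
        refine mul_le_of_le_one_right hη.le ?_
        rw [div_le_one (by positivity)]; linarith

end

end Summit.AtomisticToContinuum.HydrodynamicLimit.Theorems.TrueAnchoredInfection
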